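import Summits.KontsevichZagierPeriods.KontsevichZagierPeriods.Theorems.SoloInformedLocSplit
import Summits.KontsevichZagierPeriods.KontsevichZagierPeriods.Theorems.SoloInformedPiLocalAnchor
import HarnessLib
import HarnessLib.Audit

/-!
# SoloInformed — the anchor by name: `SoloInformedKZLocAt ⟦[π]⟧ ↔ KZ.PiLocalKernel`, and the general-`p` splitting read through it

`SoloInformedPiLocalAnchor.lean` (Literature-only imports) proved `KZ.PiLocalKernel ⟺` injectivity of
`P[⟦[π]⟧⁻¹] → ℝ`; `SoloInformedLocSplit.lean` DEFINED `SoloInformedKZLocAt p hp` as that injectivity for a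
general formal period `p` of non-zero value and proved the hypothesis-free splitting
`KZP ⟺ SoloInformedKZLocAt p hp ∧ (p cancels in P)`.  This short sequel states the identification with
both names in scope (proof: `soloInformed_kzLocAt_iff` composed with `soloInformed_piLocalKernel_iff_pow_mul_eq`), so that the conjunct of the splitting at `p = ⟦[π]⟧` is LITERALLY the Literature
library's open statement:

* `soloInformed_kzLocAtPi_iff_piLocalKernel` — `SoloInformedKZLocAt ⟦[π]⟧ _ ↔ KZ.PiLocalKernel`;
* `soloInformed_kzLocAt_iff_piLocalKernel_of_cancel` — more generally, for ANY formal period `p` of non-zero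
  value that cancels in `P` (`p·q = 0 ⇒ q = 0`) and such that `⟦[π]⟧` cancels too, the localised conjectures
  at `p` and at `⟦[π]⟧` agree: `SoloInformedKZLocAt p hp ↔ KZ.PiLocalKernel` (both are then equivalent to
  KZP by the splitting); in particular under `KZ.PiCancellation` every cancelling `p` gives the same conjunct.

References: M. Kontsevich, D. Zagier, *Periods* (2001), §4.1; J. Ayoub, EMS Newsl. 91 (2014), Def. 6, Conj. 7.
-/

noncomputable section

open Literature.NumberTheory.Transcendental Literature.NumberTheory.Transcendental.KZ

namespace Summit.KontsevichZagierPeriods.KontsevichZagierPeriods.Theorems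

/-- **The anchor by name: `SoloInformedKZLocAt ⟦[π]⟧ ↔ KZ.PiLocalKernel`** (for any proof `hp` that the
value `π` of `⟦[π]⟧` is non-zero). [Ayoub 2014, Def. 6 / Conj. 7; Kontsevich–Zagier 2001, §4.1] -/
theorem soloInformed_kzLocAtPi_iff_piLocalKernel (hp : evalP (toFormalPeriod (of piRep)) ≠ 0) :
    SoloInformedKZLocAt (toFormalPeriod (of piRep)) hp ↔ PiLocalKernel :=
  (soloInformed_kzLocAt_iff _ hp).trans soloInformed_piLocalKernel_iff_pow_mul_eq.symm

/-- Conjunct (a) of the hypothesis-free splitting `soloInformed_kzp_iff_locPi_and_piCancellation`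
is LITERALLY the Literature library's open statement `KZ.PiLocalKernel` (Ayoub's Conjecture 7
transcribed to this calculus). [Ayoub 2014, Conj. 7] -/
theorem soloInformed_kzLocAtPi_iff_piLocalKernel' :
    SoloInformedKZLocAt (toFormalPeriod (of piRep)) soloInformed_evalP_piRep_ne_zero ↔ PiLocalKernel :=
  soloInformed_kzLocAtPi_iff_piLocalKernel _

/-- The two hypothesis-free splittings of the summit at `⟦[π]⟧` — the seat's
`soloInformed_kzp_iff_locPi_and_piCancellation` (via the saturation hierarchy) and the Literature-named
`soloInformed_kzp_iff_piLocalKernel_and_piCancellation` — have propositionally equal right-hand sides. -/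
theorem soloInformed_locPiSplit_rhs_iff :
    (SoloInformedKZLocAt (toFormalPeriod (of piRep)) soloInformed_evalP_piRep_ne_zero ∧ PiCancellation) ↔
      (PiLocalKernel ∧ PiCancellation) :=
  and_congr soloInformed_kzLocAtPi_iff_piLocalKernel' Iff.rfl

/-- For any formal period `p` of non-zero value which cancels in `P`, and granting that `⟦[π]⟧`
cancels (`KZ.PiCancellation`), the localised period conjecture at `p` is the same statement as
`KZ.PiLocalKernel`: both are then equivalent to the summit by the hypothesis-free splitting
`soloInformed_kzp_iff_loc_and_cancel`. [Kontsevich–Zagier 2001, §4.1] -/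
theorem soloInformed_kzLocAt_iff_piLocalKernel_of_cancel (p : FormalPeriodRing) (hp : evalP p ≠ 0)
    (hpc : ∀ q : FormalPeriodRing, p * q = 0 → q = 0) (hπ : PiCancellation) :
    SoloInformedKZLocAt p hp ↔ PiLocalKernel := by
  constructor
  · intro hL
    exact (soloInformed_kzp_iff_piLocalKernel_and_piCancellation.1
      ((soloInformed_kzp_iff_loc_and_cancel p hp).2 ⟨hL, hpc⟩)).1
  · intro hK
    exact ((soloInformed_kzp_iff_loc_and_cancel p hp).1
      (soloInformed_kzp_iff_piLocalKernel_and_piCancellation.2 ⟨hK, hπ⟩)).1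

end Summit.KontsevichZagierPeriods.KontsevichZagierPeriods.Theorems
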